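import Summits.ABC.ABC.Theorems.FeketeScalesSubmultOfRST
import Summits.ABC.ABC.Theorems.FeketeScalesTargetOfCruxes

/-!
# Route FeketeScales — the crux `Target` (stmt-ABC-2159) from a pointwise sub-power slack

`Target := ScaleSubmultiplicativity ∧ SparseGoodScales` (route `FeketeScales`, ABC/ABC).  This file
records the upward calibration of the crux used by every line of `Cruxes/Target/`:

* `Target.sparseGoodScales_of_abc : ABC → SparseGoodScales` — conjunct 2 is an abc-consequence
  (take any large scale `R` with `C(δ/2) ≤ R^{δ/2}`);
* `Target.abc_of_subPowerSlack` — a pointwise SUB-POWER SLACK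
  `∃ τ < 1, ∃ A, ∀ abc triples, c < rad · exp(A (log rad)^τ)` implies `ABC`
  (`A (log N)^τ ≤ ε log N` once `log N` is large, the finitely many small scales being absorbed by
  the constant WITHOUT any finiteness theorem: `c < rad · exp(B (log N₀)^{τ⁺})` below the threshold);
* `Target.target_of_subPowerSlack` — hence the sub-power slack gives the whole crux `Target`
  (conjunct 1 is the route's support `submultOfRST_proof`, stmt-ABC-10340; the pairing is
  `feketeScales_targetOfCruxes_proof`, stmt-ABC-14163).

So `Target` sits between "abc with a sub-power slack" (equivalently abc with a quasi-polynomial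
constant `C(ε) = exp(A ε^{-κ})`, `τ = κ/(κ+1)`) and `ABC` itself.  Proofs adapted from the crux-ideation
sketch `Cruxes/Target/SketchIdeator2.lean` (planner-cruxidea-stmt-ABC-2159-2-0, idea
`polyconstant-omega-split`), re-cut for the tree; elementary real analysis over `IsABCTriple`/`rad`,
Mathlib only.  Helper file `--supports stmt-ABC-2159`; it closes nothing.
-/

-- `Summit.<Summit>.<Problem>` is the mandated summit-side namespace (CONVENTIONS §2); for the
-- single-conjunct summit `ABC` the two coincide, so the duplicate `ABC.ABC` is deliberate.
set_option linter.dupNamespace false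

namespace Summit.ABC.ABC.Theorems

open Literature.NumberTheory.DiophantineGeometry
open Summit.ABC.ABC.Theses.FeketeScales

/-- **Conjunct 2 of the crux is an abc-consequence.**  `ABC → SparseGoodScales`: given `δ > 0` and
`N`, abc with `ε = δ/2` and any scale `R ≥ max N 1` with `C(δ/2) ≤ R^{δ/2}` give, for every abc triple
with `rad ≤ R`, `c < C rad^{1+δ/2} ≤ R^{δ/2} R^{1+δ/2} = R^{1+δ}`. [folklore] -/
theorem Target.sparseGoodScales_of_abc (hABC : _root_.ABC) : SparseGoodScales := by
  rw [_root_.ABC_iff] at hABC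
  unfold SparseGoodScales
  intro δ hδ N
  obtain ⟨C, hC, h⟩ := hABC (δ / 2) (by linarith)
  have ht : Filter.Tendsto (fun R : ℕ => (R : ℝ) ^ (δ / 2)) Filter.atTop Filter.atTop :=
    (tendsto_rpow_atTop (by linarith)).comp tendsto_natCast_atTop_atTop
  obtain ⟨R₀, hR₀⟩ := Filter.eventually_atTop.mp (ht.eventually_ge_atTop C)
  refine ⟨max (max N 1) R₀, le_trans (le_max_left _ _) (le_max_left _ _), ?_⟩
  intro a b c habc hrad
  have hR1n : 1 ≤ max (max N 1) R₀ := le_trans (le_max_right _ _) (le_max_left _ _)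
  have hR1 : (1 : ℝ) ≤ ((max (max N 1) R₀ : ℕ) : ℝ) := by exact_mod_cast hR1n
  have hR0 : (0 : ℝ) < ((max (max N 1) R₀ : ℕ) : ℝ) := by linarith
  have hCR : C ≤ ((max (max N 1) R₀ : ℕ) : ℝ) ^ (δ / 2) := hR₀ _ (le_max_right _ _)
  have hradR : ((rad a b c : ℕ) : ℝ) ≤ ((max (max N 1) R₀ : ℕ) : ℝ) := by exact_mod_cast hrad
  have hrad0 : (0 : ℝ) ≤ ((rad a b c : ℕ) : ℝ) := Nat.cast_nonneg _
  calc (c : ℝ) ≤ C * ((rad a b c : ℕ) : ℝ) ^ (1 + δ / 2) := (h a b c habc).le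
    _ ≤ C * ((max (max N 1) R₀ : ℕ) : ℝ) ^ (1 + δ / 2) :=
        mul_le_mul_of_nonneg_left (Real.rpow_le_rpow hrad0 hradR (by linarith)) hC.le
    _ ≤ ((max (max N 1) R₀ : ℕ) : ℝ) ^ (δ / 2) * ((max (max N 1) R₀ : ℕ) : ℝ) ^ (1 + δ / 2) :=
        mul_le_mul_of_nonneg_right hCR (Real.rpow_nonneg hR0.le _)
    _ = ((max (max N 1) R₀ : ℕ) : ℝ) ^ (1 + δ) := by
        rw [← Real.rpow_add hR0]; ring_nf

/-- **A pointwise sub-power slack implies abc.**  If for some `τ < 1` and some real `A` every abc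
triple has `c < rad · exp(A (log rad)^τ)`, then `ABC`: with `t = max τ 0 < 1` and
`B = |A| max(1, (log 2)^τ)` one has `A (log rad)^τ ≤ B (log P)^t` whenever `rad ≤ P`
(`SubmultOfRST.slack_le`); above the threshold `N₀` where `B/ε ≤ (log P)^{1-t}` this is `≤ ε log rad`,
so `c < rad^{1+ε}`, and below it `c < rad · exp(B (log N₀)^t) ≤ exp(B (log N₀)^t) rad^{1+ε}`; the
constant `exp(B (log N₀)^t) + 1` serves both. [folklore] -/
theorem Target.abc_of_subPowerSlack
    (h : ∃ τ : ℝ, τ < 1 ∧ ∃ A : ℝ, ∀ a b c : ℕ, IsABCTriple a b c →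
      (c : ℝ) < ((rad a b c : ℕ) : ℝ) * Real.exp (A * Real.log ((rad a b c : ℕ) : ℝ) ^ τ)) :
    _root_.ABC := by
  obtain ⟨τ, hτ1, A, h⟩ := h
  rw [_root_.ABC_iff]
  intro ε hε
  set t : ℝ := max τ 0 with ht_def
  have ht0 : 0 ≤ t := le_max_right _ _
  have ht1 : t < 1 := max_lt hτ1 one_pos
  set B : ℝ := |A| * max 1 (Real.log 2 ^ τ) with hB_def
  have hs : 0 < 1 - t := by linarith
  obtain ⟨N₀, hN₀⟩ := SubmultOfRST.exists_threshold (B / ε) hs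
  refine ⟨Real.exp (B * Real.log (N₀ : ℝ) ^ t) + 1, by positivity, ?_⟩
  intro a b c habc
  have hrad2 : (2 : ℝ) ≤ ((rad a b c : ℕ) : ℝ) := by exact_mod_cast SubmultOfRST.two_le_rad habc
  have hrad0 : (0 : ℝ) < ((rad a b c : ℕ) : ℝ) := by linarith
  have hrad1 : (1 : ℝ) ≤ ((rad a b c : ℕ) : ℝ) := by linarith
  have hlog0 : 0 ≤ Real.log ((rad a b c : ℕ) : ℝ) := Real.log_nonneg hrad1
  have hc := h a b c habc
  have hpow1 : ((rad a b c : ℕ) : ℝ) ≤ ((rad a b c : ℕ) : ℝ) ^ (1 + ε) := by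
    calc ((rad a b c : ℕ) : ℝ) = ((rad a b c : ℕ) : ℝ) ^ (1 : ℝ) := (Real.rpow_one _).symm
      _ ≤ ((rad a b c : ℕ) : ℝ) ^ (1 + ε) := Real.rpow_le_rpow_of_exponent_le hrad1 (by linarith)
  have hpowpos : 0 < ((rad a b c : ℕ) : ℝ) ^ (1 + ε) := Real.rpow_pos_of_pos hrad0 _
  rcases le_or_gt N₀ (rad a b c) with hN | hN
  · -- large radical: `A (log rad)^τ ≤ B (log rad)^t ≤ ε log rad`, so `c < rad^{1+ε}`
    have hslack : A * Real.log ((rad a b c : ℕ) : ℝ) ^ τ ≤ B * Real.log ((rad a b c : ℕ) : ℝ) ^ t :=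
      SubmultOfRST.slack_le habc le_rfl
    have hthr : B / ε ≤ Real.log ((rad a b c : ℕ) : ℝ) ^ (1 - t) := hN₀ _ hN
    have hBt : B * Real.log ((rad a b c : ℕ) : ℝ) ^ t ≤ ε * Real.log ((rad a b c : ℕ) : ℝ) := by
      have e1 : ε * Real.log ((rad a b c : ℕ) : ℝ)
          = ε * Real.log ((rad a b c : ℕ) : ℝ) ^ (1 - t) * Real.log ((rad a b c : ℕ) : ℝ) ^ t := by
        rw [mul_assoc, ← Real.rpow_add_of_nonneg hlog0 hs.le ht0]; norm_num
      rw [e1]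
      apply mul_le_mul_of_nonneg_right _ (Real.rpow_nonneg hlog0 _)
      rwa [div_le_iff₀ hε, mul_comm] at hthr
    have hexp : Real.exp (A * Real.log ((rad a b c : ℕ) : ℝ) ^ τ) ≤ ((rad a b c : ℕ) : ℝ) ^ ε := by
      calc Real.exp (A * Real.log ((rad a b c : ℕ) : ℝ) ^ τ)
            ≤ Real.exp (ε * Real.log ((rad a b c : ℕ) : ℝ)) := Real.exp_le_exp.mpr (hslack.trans hBt)
        _ = ((rad a b c : ℕ) : ℝ) ^ ε := by
            rw [Real.rpow_def_of_pos hrad0, mul_comm]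
    calc (c : ℝ) < ((rad a b c : ℕ) : ℝ) * Real.exp (A * Real.log ((rad a b c : ℕ) : ℝ) ^ τ) := hc
      _ ≤ ((rad a b c : ℕ) : ℝ) * ((rad a b c : ℕ) : ℝ) ^ ε := mul_le_mul_of_nonneg_left hexp hrad0.le
      _ = ((rad a b c : ℕ) : ℝ) ^ (1 + ε) := by
          rw [Real.rpow_add hrad0, Real.rpow_one]
      _ = 1 * ((rad a b c : ℕ) : ℝ) ^ (1 + ε) := (one_mul _).symm
      _ < (Real.exp (B * Real.log (N₀ : ℝ) ^ t) + 1) * ((rad a b c : ℕ) : ℝ) ^ (1 + ε) := by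
          apply mul_lt_mul_of_pos_right _ hpowpos
          linarith [Real.exp_pos (B * Real.log (N₀ : ℝ) ^ t)]
  · -- small radical `rad < N₀`: `A (log rad)^τ ≤ B (log N₀)^t`
    have hslack : A * Real.log ((rad a b c : ℕ) : ℝ) ^ τ ≤ B * Real.log (N₀ : ℝ) ^ t :=
      SubmultOfRST.slack_le habc hN.le
    calc (c : ℝ) < ((rad a b c : ℕ) : ℝ) * Real.exp (A * Real.log ((rad a b c : ℕ) : ℝ) ^ τ) := hc
      _ ≤ ((rad a b c : ℕ) : ℝ) ^ (1 + ε) * Real.exp (B * Real.log (N₀ : ℝ) ^ t) :=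
          mul_le_mul hpow1 (Real.exp_le_exp.mpr hslack) (Real.exp_pos _).le
            (Real.rpow_nonneg hrad0.le _)
      _ < ((rad a b c : ℕ) : ℝ) ^ (1 + ε) * Real.exp (B * Real.log (N₀ : ℝ) ^ t)
            + ((rad a b c : ℕ) : ℝ) ^ (1 + ε) := lt_add_of_pos_right _ hpowpos
      _ = (Real.exp (B * Real.log (N₀ : ℝ) ^ t) + 1) * ((rad a b c : ℕ) : ℝ) ^ (1 + ε) := by ring

/-- **A pointwise sub-power slack gives the crux `Target`** (stmt-ABC-2159): conjunct 1
(`ScaleSubmultiplicativity`) is the route's support `submultOfRST_proof` (stmt-ABC-10340) applied to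
the slack, conjunct 2 (`SparseGoodScales`) follows from `ABC` (`Target.abc_of_subPowerSlack`,
`Target.sparseGoodScales_of_abc`), and `feketeScales_targetOfCruxes_proof` pairs them.  This is the
transfer `C⁺ → Target` of every line of the crux (C⁺ = sub-power-slack abc). [folklore] -/
theorem Target.target_of_subPowerSlack
    (h : ∃ τ : ℝ, τ < 1 ∧ ∃ A : ℝ, ∀ a b c : ℕ, IsABCTriple a b c →
      (c : ℝ) < ((rad a b c : ℕ) : ℝ) * Real.exp (A * Real.log ((rad a b c : ℕ) : ℝ) ^ τ)) :
    Target :=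
  feketeScales_targetOfCruxes_proof (submultOfRST_proof h)
    (Target.sparseGoodScales_of_abc (Target.abc_of_subPowerSlack h))

end Summit.ABC.ABC.Theorems
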